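import Literature.NumberTheory.Automorphic.SelfDualLatticeCountFrameTransport                   -- ★ (L5-d1) FILE A: `ncard_selfDualStable_eq_of_eigenframe_of_rescaling`
import Literature.NumberTheory.Automorphic.QuadraticLocalUnramifiedUnitNorm                      -- ★ units are norms at an unramified place (CM form)
import Literature.NumberTheory.Automorphic.Liu2021.LemD1AsPrintedIndexedNonVacuityInertCofinite  -- ★ `valued_toPlace_uniformizer_of_isUnramifiedIn`
import Literature.NumberTheory.Rogawski1990.ExplicitFactorKappaAlmostEverywhereOne               -- ★ `conjLocal_apply_eq_galAdicCompletionMap`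
import Literature.NumberTheory.Rogawski1990.LocalStableClassesNonsplitTypeOneCount               -- ★ L4a FILE 1 + `twistGram_mul_eigenframe_apply_ne_zero`
import Literature.NumberTheory.Automorphic.LocalUnitaryGroupCongr                                -- ★ `antidiagOne_isHermitian`, `map_cmConjRingHom_eq_map_complexConj`
import Literature.NumberTheory.Automorphic.LocalUnitaryIntegralLevel                             -- ★ `placeForm_antidiagOne`
import Literature.NumberTheory.Automorphic.UnitaryGroupInertPlaceHyperbolicBasis                 -- ★ `placeForm_hermitian_of_smul_eq`, `galAdicCompletionMap_galAdicCompletionMap_of_smul_eq`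
import HarnessLib

/-!
# Frame transport for the count of `γ`-stable self-dual lattices at an UNRAMIFIED NON-SPLIT place of a CM field: rescaling an eigenframe to the scalar form
# `ϖ^e • 1`, `e ∈ {0, 1}`, and the parity flip between the two local classes (Flicker 1998 §6 p. 95; Rogawski 1990 §4.9 Lemma 4.9.3; O'Meara 63:16)

Topic `NumberTheory/Automorphic`; namespace `Literature.NumberTheory.Automorphic.UnitaryGroup`.  THEOREMS ONLY (no definition, no instance, no notation, no named fact,
no `sorry`; count-neutral for the books).  Cell `pub/hodgecm-mathlib`, F0∕P3a road «D-N7-inert», brick **(L5-d1) «FRAME TRANSPORT», FILE B** (the CM∕unramified arithmetic)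
of the H-side count (L5)∕(F9) [Flicker1998UnitaryFL §6 p. 95] (B-p10 (g24) integrator; LEAD F0P3a-plan (g9) T8-35 (C)∕T8-42).  FILE A ★ `SelfDualLatticeCountFrameTransport`
gives `#S(J, γ) = #S(t • 1, diag u)` once column scalars `c` with `σ(cᵢ) (H_P)ᵢᵢ cᵢ = t` are PROVIDED; this file PROVIDES them at the one place `w` above a
non-split `v` UNRAMIFIED in the CM field `L` (`K = L_w`, `σ = σ_w = galAdicCompletionMap c hw`, `ϖ = ι_w(ϖ_v)` a `σ_w`-FIXED uniformizer of `L_w`), with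
`t = ϖ^e`, `e ∈ {0, 1}` the parity of `ord_w (H_P)₀₀`.  HONEST LABEL: HC_CM is proved only modulo the printed citations until rung 0 closes; no letter here.

THE MATHEMATICS.  (i) `ϖ := ι_w ϖ_v` is a uniformizer of `L_w` (`e(w|v) = 1`, ★ `valued_toPlace_uniformizer_of_isUnramifiedIn`) fixed by `σ_w` (★ `galAdicCompletionMap_toPlace`).
(ii) UNITS ARE NORMS at an unramified place (O'Meara 63:16, ★ `exists_isUnit_eq_mul_conjLocal_complexConj_of_isUnramifiedIn`, read at the single factor `w` of
`L ⊗ L⁺_v`): a `σ_w`-fixed `r` with `v_w(r) = 1` is `z σ_w(z)`.  (iii) Hence every `σ_w`-fixed `r ≠ 0` RESCALES TO A UNIFORMIZER POWER OF ITS PARITY: with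
`ord_w r = 2k + e`, `e ∈ {0,1}`, `r ϖ^{−(2k+e)} = z σ_w z` and `c := (z ϖ^k)⁻¹` gives `σ_w(c) r c = ϖ^e` (`exists_mul_map_mul_eq_uniformizer_pow`); in particular a
`σ_w`-fixed `r ≠ 0` of EVEN order is a norm `σ_w(z) z`, `z ≠ 0` (`exists_eq_map_mul_of_even`), so two `σ_w`-fixed non-zero elements NOT differing by a norm have orders
of DIFFERENT parity (`not_even_sub_of_not_exists_eq_norm_mul` — the flip between Flicker's `t₁, t₂`, read on ★ `LocalStableClassesNonsplitRankTwo`'s `¬ T g 0`).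
(iv) For `γ ∈ U(σ_w, J)(L_w)` with an eigenframe `γ P = P diag(u)` of distinct norm-one eigenvalues, `H_P = ᵗσ(P) J P = diag(d₀, d₁)` (★ `twistGram_eigenframe_eq_diagonal`)
with `d₀ d₁ = N(det P) det J`, so for `det J` of EVEN order (e.g. `Φ₂`, `det = −1`) the two orders have the same parity `e` and (iii) rescales BOTH columns to `ϖ^e`:
**`exists_rescaling_formCongr_eq_uniformizer_pow_smul_one`**, whence by FILE A **`exists_ncard_selfDualStable_eq_smul_one`**: `#S(J, γ) = #S(ϖ^e • 1, diag u)` with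
`e ≤ 1` and `e ≡ ord_w (H_P)₀₀ (mod 2)` — the normalised count of (L5-b) (B-p04) applies, and the two classes of (L5-e) carry `e` and `1 − e`.
(v) §5 THE CM CARRIERS: `(Φ₂)_w` is `σ_w`-hermitian with `det = −1` (even order), so **`exists_ncard_selfDualStable_antidiagTwo_eq_smul_one`** is hypothesis-free at `Φ₂`; and
the parity flip read on the norm test of ★ `LocalStableClassesNonsplitRankTwo` over `E_v = L ⊗ L⁺_v` (**`even_log_twistGram_apply_iff_not_of_not_normTest`**).
(vi) §6 the CONSUMER'S SHAPE (form `ϖ ^ (e : ℤ) • 1`, element a `GL₂` representative `γ′` of `!![u₀, 0; 0, u₁]`, as read by ★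
`ncard_selfDualStable_smul_one_diag_eq_sum`): **`exists_ncard_selfDualStable_antidiagTwo_eq_zpow_smul_one`**.

## References
* [Flicker1998UnitaryFL] Y. Z. Flicker, *Elementary proof of the fundamental lemma for a unitary group*, Canad. J. Math. 50 (1998), §6 p. 95 (`t₁, t₂`; `Φ^st = Φ(t₁) + Φ(t₂)`).
* [Rogawski1990] J. D. Rogawski, *Automorphic Representations of Unitary Groups in Three Variables*, Ann. of Math. Stud. 123 (1990), §4.9 Lemma 4.9.3 p. 56, §3.5 p. 29.
* [Omeara1963] O. T. O'Meara, *Introduction to Quadratic Forms* (1963), §63C Example 63:16 (norms at an unramified place = elements of even order).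
* [Kottwitz1986] R. E. Kottwitz, *Base change for unit elements of Hecke algebras*, Compositio Math. 60 (1986), §3.
-/

set_option autoImplicit false

noncomputable section

open scoped ValuativeRel Matrix MatrixGroups
open Set Matrix NumberField IsDedekindDomain

namespace Literature.NumberTheory.Automorphic.UnitaryGroup

open Literature.NumberTheory.Rogawski1990 Literature.NumberTheory.GaloisRepresentations

variable (L : Type) [Field L] [NumberField L] [IsCMField L] (v : HeightOneSpectrum (𝓞 ↥(maximalRealSubfield L)))
  (w : PlacesOver L v) (hw : IsCMField.complexConj L • w.1 = w.1)

/-! ## §1 The `σ_w`-fixed uniformizer `ϖ = ι_w(ϖ_v)` at an unramified place -/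

section Uniformizer

/-- **`σ_w` fixes `ι_w(y)`** for every `y ∈ L⁺_v` (★ `galAdicCompletionMap_toPlace` at `w′ = w`). [cite: CasselsFrohlichANT1967, Ch. II §10] -/
theorem galAdicCompletionMap_toPlace_self (y : v.adicCompletion ↥(maximalRealSubfield L)) :
    galAdicCompletionMap (L := L) (IsCMField.complexConj L) hw (toPlace v w y) = toPlace v w y :=
  galAdicCompletionMap_toPlace (IsCMField.complexConj L) w w hw y

omit [IsCMField L] in
/-- **`ϖ := ι_w(ϖ_v)` is a uniformizer of `L_w`** at a place `v` unramified in `L`: `v_w(ϖ) = exp(−1)` (★ `valued_toPlace_uniformizer_of_isUnramifiedIn`).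
[cite: NeukirchANT1999, Ch. II §6] -/
theorem valued_toPlace_uniformizer (hunr : Algebra.IsUnramifiedIn (𝓞 L) v.asIdeal) :
    Valued.v (toPlace v w (HeckeCharacter.uniformizer ↥(maximalRealSubfield L) v : v.adicCompletion ↥(maximalRealSubfield L))) =
      WithZero.exp (-1 : ℤ) :=
  Liu2021.LemD1IndexedNonVacuityInertCofinite.valued_toPlace_uniformizer_of_isUnramifiedIn L v hunr w

omit [IsCMField L] in
/-- `ϖ ≠ 0`. [cite: NeukirchANT1999, Ch. II §6] -/
theorem toPlace_uniformizer_ne_zero (hunr : Algebra.IsUnramifiedIn (𝓞 L) v.asIdeal) :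
    toPlace v w (HeckeCharacter.uniformizer ↥(maximalRealSubfield L) v : v.adicCompletion ↥(maximalRealSubfield L)) ≠ 0 := by
  intro h0
  have h := valued_toPlace_uniformizer L v w hunr
  rw [h0, map_zero] at h
  exact WithZero.zero_ne_coe h

omit [IsCMField L] in
/-- `v_w(ϖ^n) = exp(−n)` for `n : ℤ`. [cite: NeukirchANT1999, Ch. II §6] -/
theorem valued_toPlace_uniformizer_zpow (hunr : Algebra.IsUnramifiedIn (𝓞 L) v.asIdeal) (n : ℤ) :
    Valued.v (toPlace v w (HeckeCharacter.uniformizer ↥(maximalRealSubfield L) v : v.adicCompletion ↥(maximalRealSubfield L)) ^ n) =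
      WithZero.exp (-n) := by
  rw [map_zpow₀, valued_toPlace_uniformizer L v w hunr, ← WithZero.exp_zsmul, smul_eq_mul, mul_neg, mul_one]

end Uniformizer

/-! ## §2 Units are norms at `w`: a `σ_w`-fixed element of valuation one is `z · σ_w(z)` -/

section Norms

include hw in
/-- **UNITS ARE NORMS at an unramified non-split place, on the local FIELD `L_w`**: a `σ_w`-fixed `r ∈ L_w` with `v_w(r) = 1` is `z · σ_w(z)` with `z ≠ 0` — ★
`exists_isUnit_eq_mul_conjLocal_complexConj_of_isUnramifiedIn` (O'Meara 63:16 on `L ⊗ L⁺_v`) read at the single factor `w` (`L ⊗ L⁺_v = L_w`, Mathlib `RingEquiv.piUnique`;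
`(c ⊗ 1)(x)_w = σ_w(x_w)`, ★ `conjLocal_apply_eq_galAdicCompletionMap`). [cite: Omeara1963, §63C Example 63:16] [cite: CasselsFrohlichANT1967, Ch. II §10] -/
theorem exists_eq_mul_galAdicCompletionMap_of_valued_eq_one (hunr : Algebra.IsUnramifiedIn (𝓞 L) v.asIdeal) {r : w.1.adicCompletion L}
    (hfix : galAdicCompletionMap (L := L) (IsCMField.complexConj L) hw r = r) (hr : Valued.v r = 1) :
    ∃ z : w.1.adicCompletion L, z ≠ 0 ∧ r = z * galAdicCompletionMap (L := L) (IsCMField.complexConj L) hw z := by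
  haveI : Subsingleton (PlacesOver L v) :=
    PlacesOver.subsingleton_of_smul_eq (IsCMField.complexConj L) (IsCMField.complexConj_ne_one L) w hw
  letI : Unique (PlacesOver L v) := uniqueOfSubsingleton w
  let π : LocalRing L v ≃+* w.1.adicCompletion L := RingEquiv.piUnique fun w' : PlacesOver L v => w'.1.adicCompletion L
  obtain ⟨x, hxw⟩ : ∃ x : LocalRing L v, x w = r := ⟨π.symm r, π.apply_symm_apply r⟩
  have hconj : conjLocal L (IsCMField.complexConj L) v x = x := by
    rw [LocalRing.eq_iff_apply_eq (IsCMField.complexConj L) (IsCMField.complexConj_ne_one L) w hw,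
      conjLocal_apply_eq_galAdicCompletionMap L v w hw x, hxw, hfix]
  have hunit : ∀ w' : PlacesOver L v, Valued.v (x w') = 1 := by
    intro w'
    obtain rfl : w' = w := Subsingleton.elim w' w
    rw [hxw, hr]
  obtain ⟨z, hz, hxz⟩ := exists_isUnit_eq_mul_conjLocal_complexConj_of_isUnramifiedIn L v hunr hconj hunit
  refine ⟨z w, (Pi.isUnit_iff.1 hz w).ne_zero, ?_⟩
  have h := congrFun hxz w
  rw [hxw, Pi.mul_apply, conjLocal_apply_eq_galAdicCompletionMap L v w hw z] at h
  exact h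

end Norms

/-! ## §3 Rescaling a `σ_w`-fixed element to a uniformizer power of its parity -/

section Rescaling

/-- Parity decomposition of an integer: `n = 2k + e` with `e ∈ {0, 1}`. [folklore] -/
private theorem exists_eq_two_mul_add (n : ℤ) : ∃ (k : ℤ) (e : ℕ), e ≤ 1 ∧ n = 2 * k + e ∧ (Even n ↔ e = 0) := by
  rcases Int.emod_two_eq_zero_or_one n with h | h
  · refine ⟨n / 2, 0, zero_le_one, ?_, ?_⟩
    · push_cast; omega
    · simp [Int.even_iff, h]
  · refine ⟨n / 2, 1, le_rfl, ?_, ?_⟩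
    · push_cast; omega
    · simp [Int.even_iff, h]

include hw in
/-- **RESCALING TO `ϖ^e`**: at an unramified non-split place, for a `σ_w`-fixed `r ≠ 0` of `L_w` there are `c ≠ 0` and `e ∈ {0, 1}` with `σ_w(c) · r · c = ϖ^e`, where
`e` is the PARITY of the order of `r` (`Even (log v_w r) ↔ e = 0`): with `log v_w(r) = n = 2k + e′`… precisely, `r · ϖ^{n}` has valuation one and is `σ_w`-fixed, hence a norm
`z σ_w(z)` (§2), and `c := (z · ϖ^k)⁻¹` for `−n = 2k + e`. [cite: Omeara1963, §63C Example 63:16] [cite: Flicker1998UnitaryFL, §6 p. 95] -/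
theorem exists_mul_map_mul_eq_uniformizer_pow (hunr : Algebra.IsUnramifiedIn (𝓞 L) v.asIdeal) {r : w.1.adicCompletion L}
    (hfix : galAdicCompletionMap (L := L) (IsCMField.complexConj L) hw r = r) (hr0 : r ≠ 0) :
    ∃ (c : w.1.adicCompletion L) (e : ℕ), c ≠ 0 ∧ e ≤ 1 ∧ (Even (WithZero.log (Valued.v r)) ↔ e = 0) ∧
      galAdicCompletionMap (L := L) (IsCMField.complexConj L) hw c * r * c =
        toPlace v w (HeckeCharacter.uniformizer ↥(maximalRealSubfield L) v : v.adicCompletion ↥(maximalRealSubfield L)) ^ e := by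
  set σ := galAdicCompletionMap (L := L) (IsCMField.complexConj L) hw with hσ
  set ϖ : w.1.adicCompletion L :=
    toPlace v w (HeckeCharacter.uniformizer ↥(maximalRealSubfield L) v : v.adicCompletion ↥(maximalRealSubfield L)) with hϖ
  have hϖ0 : ϖ ≠ 0 := toPlace_uniformizer_ne_zero L v w hunr
  have hσϖ : σ ϖ = ϖ := galAdicCompletionMap_toPlace_self L v w hw _
  set n : ℤ := WithZero.log (Valued.v r) with hn
  -- `−n = 2k + e`
  obtain ⟨k, e, he1, hke, hpar⟩ := exists_eq_two_mul_add (-n)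
  -- `r₁ := r · ϖ^n` is a `σ_w`-fixed element of valuation one
  have hvr : Valued.v r = WithZero.exp n := by rw [hn, WithZero.exp_log ((Valuation.ne_zero_iff _).2 hr0)]
  have hr₁ : Valued.v (r * ϖ ^ n) = 1 := by
    rw [map_mul, hvr, valued_toPlace_uniformizer_zpow L v w hunr, ← WithZero.exp_add, add_neg_cancel, WithZero.exp_zero]
  have hfix₁ : σ (r * ϖ ^ n) = r * ϖ ^ n := by rw [map_mul, map_zpow₀, hfix, hσϖ]
  obtain ⟨z, hz0, hz⟩ := exists_eq_mul_galAdicCompletionMap_of_valued_eq_one L v w hw hunr hfix₁ hr₁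
  -- `c := (z ϖ^k)⁻¹`
  refine ⟨(z * ϖ ^ k)⁻¹, e, inv_ne_zero (mul_ne_zero hz0 (zpow_ne_zero k hϖ0)), he1, ?_, ?_⟩
  · rw [even_neg] at hpar
    exact hpar
  · -- `σ(c) r c = (σ z ϖ^k)⁻¹ · r · (z ϖ^k)⁻¹ = r ϖ^{−2k} ∕ (z σ z) = r ϖ^{−2k} ∕ (r ϖ^n) = ϖ^{−2k−n} = ϖ^e`
    have hzσz : z * σ z ≠ 0 := by rw [← hz]; exact mul_ne_zero hr0 (zpow_ne_zero n hϖ0)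
    have hσz0 : σ z ≠ 0 := fun h0 => hzσz (by rw [h0, mul_zero])
    rw [map_inv₀, map_mul, map_zpow₀, hσϖ]
    have key : r = z * σ z * ϖ ^ (-n) := by
      rw [← hz, mul_assoc, ← zpow_add₀ hϖ0, add_neg_cancel, zpow_zero, mul_one]
    rw [key, hke]
    have e1 : (σ z * ϖ ^ k)⁻¹ * (z * σ z * ϖ ^ (2 * k + (e : ℤ))) * (z * ϖ ^ k)⁻¹ =
        (z * σ z) * (z * σ z)⁻¹ * (ϖ ^ (2 * k + (e : ℤ)) * (ϖ ^ k)⁻¹ * (ϖ ^ k)⁻¹) := by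
      field_simp
    rw [e1, mul_inv_cancel₀ hzσz, one_mul, ← _root_.zpow_neg, ← zpow_add₀ hϖ0, ← zpow_add₀ hϖ0,
      show 2 * k + (e : ℤ) + -k + -k = (e : ℤ) by ring, zpow_natCast]

include hw in
/-- **A `σ_w`-fixed non-zero element of EVEN order is a norm `σ_w(z) · z`, `z ≠ 0`** (§3 with `e = 0`: `σ_w(c) r c = 1`, `z := c⁻¹`).
[cite: Omeara1963, §63C Example 63:16] -/
theorem exists_eq_map_mul_of_even (hunr : Algebra.IsUnramifiedIn (𝓞 L) v.asIdeal) {r : w.1.adicCompletion L}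
    (hfix : galAdicCompletionMap (L := L) (IsCMField.complexConj L) hw r = r) (hr0 : r ≠ 0) (heven : Even (WithZero.log (Valued.v r))) :
    ∃ z : w.1.adicCompletion L, z ≠ 0 ∧ r = galAdicCompletionMap (L := L) (IsCMField.complexConj L) hw z * z := by
  obtain ⟨c, e, hc0, -, hpar, hc⟩ := exists_mul_map_mul_eq_uniformizer_pow L v w hw hunr hfix hr0
  rw [hpar.1 heven, pow_zero] at hc
  have hσc0 : galAdicCompletionMap (L := L) (IsCMField.complexConj L) hw c ≠ 0 := fun h0 => by
    rw [h0, zero_mul, zero_mul] at hc; exact zero_ne_one hc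
  refine ⟨c⁻¹, inv_ne_zero hc0, ?_⟩
  rw [map_inv₀]
  have e1 : r = (galAdicCompletionMap (L := L) (IsCMField.complexConj L) hw c)⁻¹ *
      (galAdicCompletionMap (L := L) (IsCMField.complexConj L) hw c * r * c) * c⁻¹ := by
    field_simp
  rw [e1, hc, mul_one]

include hw in
/-- **THE PARITY FLIP**: two `σ_w`-fixed non-zero elements `a, b` NOT differing by a norm (`¬ ∃ z ≠ 0, a = σ_w(z) z · b` — the failed norm test of ★
`LocalStableClassesNonsplitRankTwo`, Flicker's second class `t₂`) have orders of DIFFERENT parity: `Even (log v_w a) ↔ ¬ Even (log v_w b)`.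
[cite: Omeara1963, §63C Example 63:16] [cite: Flicker1998UnitaryFL, §6 p. 95] [cite: Rogawski1990, §3.5 Prop. 3.5.2 (c) p. 29] -/
theorem even_log_iff_not_even_log_of_not_exists_eq_norm_mul (hunr : Algebra.IsUnramifiedIn (𝓞 L) v.asIdeal) {a b : w.1.adicCompletion L}
    (ha : galAdicCompletionMap (L := L) (IsCMField.complexConj L) hw a = a) (ha0 : a ≠ 0)
    (hb : galAdicCompletionMap (L := L) (IsCMField.complexConj L) hw b = b) (hb0 : b ≠ 0)
    (hnot : ¬ ∃ z : w.1.adicCompletion L, z ≠ 0 ∧ a = galAdicCompletionMap (L := L) (IsCMField.complexConj L) hw z * z * b) :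
    Even (WithZero.log (Valued.v a)) ↔ ¬ Even (WithZero.log (Valued.v b)) := by
  set σ := galAdicCompletionMap (L := L) (IsCMField.complexConj L) hw with hσ
  -- the ratio `ρ = a b⁻¹` is `σ_w`-fixed, non-zero, and NOT a norm
  have hρfix : σ (a * b⁻¹) = a * b⁻¹ := by rw [map_mul, map_inv₀, ha, hb]
  have hρ0 : a * b⁻¹ ≠ 0 := mul_ne_zero ha0 (inv_ne_zero hb0)
  have hρnot : ¬ Even (WithZero.log (Valued.v (a * b⁻¹))) := by
    intro hev
    obtain ⟨z, hz0, hz⟩ := exists_eq_map_mul_of_even L v w hw hunr hρfix hρ0 hev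
    exact hnot ⟨z, hz0, by rw [← hz, inv_mul_cancel_right₀ hb0]⟩
  rw [map_mul, map_inv₀, WithZero.log_mul ((Valuation.ne_zero_iff _).2 ha0) (inv_ne_zero ((Valuation.ne_zero_iff _).2 hb0)),
    WithZero.log_inv] at hρnot
  rw [Int.even_add, even_neg] at hρnot
  tauto

end Rescaling

/-! ## §4 Eigenframes of a rank-2 unitary element: rescaling the form to `ϖ^e • 1` and the transported count -/

section Frame

include hw in
/-- **RESCALING AN EIGENFRAME TO THE SCALAR FORM `ϖ^e • 1`** (rank 2, unramified non-split `v`): `J ∈ M₂(L_w)` `σ_w`-hermitian with `det J ≠ 0` of EVEN order (e.g. `Φ₂`,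
`det = −1`), `γ ∈ U(σ_w, J)` with an eigenframe `γ P = P · diag(u)`, `u₀ ≠ u₁`, `σ_w(uᵢ) uᵢ = 1`: there are column scalars `c` (a diagonal `D`) and `e ∈ {0,1}` with
`ᵗσ_w(P D) J (P D) = ϖ^e • 1`, and `e` is the parity of the order of `(H_P)₀₀ = ⟨p₀, p₀⟩_J` — `H_P` is diagonal (★ `twistGram_eigenframe_eq_diagonal`), its entries are `σ_w`-fixed,
non-zero, of the same parity (`(H_P)₀₀ (H_P)₁₁ = N(det P) det J`), and each rescales to `ϖ^e` (§3). [cite: Rogawski1990, §3.5 p. 29; §4.9 Lemma 4.9.3 p. 56] [cite: Flicker1998UnitaryFL, §6 p. 95] -/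
theorem exists_rescaling_formCongr_eq_uniformizer_pow_smul_one (hunr : Algebra.IsUnramifiedIn (𝓞 L) v.asIdeal)
    {J : Matrix (Fin 2) (Fin 2) (w.1.adicCompletion L)} (hJ : (J.map (galAdicCompletionMap (L := L) (IsCMField.complexConj L) hw))ᵀ = J)
    (hJ0 : J.det ≠ 0) (hJev : Even (WithZero.log (Valued.v J.det)))
    {γ P : GL (Fin 2) (w.1.adicCompletion L)} {u : Fin 2 → w.1.adicCompletion L}
    (hγ : γ ∈ Literature.AlgebraicGeometry.ShimuraVarieties.unitaryGroup (galAdicCompletionMap (L := L) (IsCMField.complexConj L) hw) J)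
    (hP : (γ : Matrix (Fin 2) (Fin 2) (w.1.adicCompletion L)) * P = P * diagonal u) (hu : Function.Injective u)
    (hu1 : ∀ i, galAdicCompletionMap (L := L) (IsCMField.complexConj L) hw (u i) * u i = 1) :
    ∃ (c : Fin 2 → w.1.adicCompletion L) (D : GL (Fin 2) (w.1.adicCompletion L)) (e : ℕ),
      (D : Matrix (Fin 2) (Fin 2) (w.1.adicCompletion L)) = diagonal c ∧ e ≤ 1 ∧
      (Even (WithZero.log (Valued.v (twistGram (galAdicCompletionMap (L := L) (IsCMField.complexConj L) hw) J P.val 0 0))) ↔ e = 0) ∧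
      formCongr (galAdicCompletionMap (L := L) (IsCMField.complexConj L) hw) (P * D) J =
        toPlace v w (HeckeCharacter.uniformizer ↥(maximalRealSubfield L) v : v.adicCompletion ↥(maximalRealSubfield L)) ^ e •
          (1 : Matrix (Fin 2) (Fin 2) (w.1.adicCompletion L)) := by
  set σ := galAdicCompletionMap (L := L) (IsCMField.complexConj L) hw with hσ
  have hσσ : ∀ x, σ (σ x) = x :=
    galAdicCompletionMap_galAdicCompletionMap_of_smul_eq (IsCMField.complexConj L) w (IsCMField.complexConj_ne_one L) hw
  -- `H_P = diag(d)` with `σ`-fixed non-zero entries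
  set d : Fin 2 → w.1.adicCompletion L := fun i => twistGram σ J P.val i i with hd
  have hHP : twistGram σ J P.val = diagonal d := twistGram_eigenframe_eq_diagonal σ J hγ hP hu hu1
  have hdfix : ∀ i, σ (d i) = d i := fun i => map_twistGram_apply_self σ J hσσ hJ P.val i
  have hd0 : ∀ i, d i ≠ 0 := fun i => twistGram_eigenframe_apply_ne_zero σ J hJ0 hγ hP hu hu1 i
  -- rescale each entry
  obtain ⟨c₀, e₀, hc₀, he₀, hpar₀, hce₀⟩ := exists_mul_map_mul_eq_uniformizer_pow L v w hw hunr (hdfix 0) (hd0 0)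
  obtain ⟨c₁, e₁, hc₁, he₁, hpar₁, hce₁⟩ := exists_mul_map_mul_eq_uniformizer_pow L v w hw hunr (hdfix 1) (hd0 1)
  -- the two parities agree: `d₀ d₁ = σ(det P) det J det P`, of even order
  have hdet : d 0 * d 1 = σ (P.val.det) * J.det * P.val.det := by
    have h := congrArg Matrix.det hHP
    rw [det_twistGram, det_diagonal, Fin.prod_univ_two] at h
    exact h.symm
  have hP0 : P.val.det ≠ 0 := by
    have h := P.isUnit
    rw [Matrix.isUnit_iff_isUnit_det] at h
    exact h.ne_zero
  have hsame : Even (WithZero.log (Valued.v (d 0))) ↔ Even (WithZero.log (Valued.v (d 1))) := by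
    have h := congrArg (fun x => WithZero.log (Valued.v x)) hdet
    rw [map_mul, map_mul, map_mul, valued_galAdicCompletionMap,
      WithZero.log_mul ((Valuation.ne_zero_iff _).2 (hd0 0)) ((Valuation.ne_zero_iff _).2 (hd0 1)),
      WithZero.log_mul (mul_ne_zero ((Valuation.ne_zero_iff _).2 hP0) ((Valuation.ne_zero_iff _).2 hJ0)) ((Valuation.ne_zero_iff _).2 hP0),
      WithZero.log_mul ((Valuation.ne_zero_iff _).2 hP0) ((Valuation.ne_zero_iff _).2 hJ0)] at h
    -- `log d₀ + log d₁ = 2 log det P + log det J` is even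
    have hsum : Even (WithZero.log (Valued.v (d 0)) + WithZero.log (Valued.v (d 1))) := by
      rw [h]
      have : WithZero.log (Valued.v P.val.det) + WithZero.log (Valued.v J.det) + WithZero.log (Valued.v P.val.det) =
          2 * WithZero.log (Valued.v P.val.det) + WithZero.log (Valued.v J.det) := by ring
      rw [this]
      exact (even_two_mul _).add hJev
    rw [Int.even_add] at hsum
    exact hsum
  have hee : e₀ = e₁ := by
    rcases Nat.le_one_iff_eq_zero_or_eq_one.1 he₀ with h0 | h0 <;> rcases Nat.le_one_iff_eq_zero_or_eq_one.1 he₁ with h1 | h1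
    · rw [h0, h1]
    · exfalso; have := (hpar₁.1 (hsame.1 (hpar₀.2 h0))); omega
    · exfalso; have := (hpar₀.1 (hsame.2 (hpar₁.2 h1))); omega
    · rw [h0, h1]
  -- the diagonal rescaling
  have hcne : ∀ i, (![c₀, c₁] : Fin 2 → w.1.adicCompletion L) i ≠ 0 := fun i => by
    fin_cases i
    · exact hc₀
    · exact hc₁
  have hDdet : (diagonal (![c₀, c₁] : Fin 2 → w.1.adicCompletion L)).det ≠ 0 := by
    rw [det_diagonal]
    exact Finset.prod_ne_zero_iff.2 fun i _ => hcne i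
  let D : GL (Fin 2) (w.1.adicCompletion L) := Matrix.GeneralLinearGroup.mkOfDetNeZero _ hDdet
  have hD : (D : Matrix (Fin 2) (Fin 2) (w.1.adicCompletion L)) = diagonal ![c₀, c₁] := rfl
  have hPJ : formCongr σ P J = diagonal d := hHP
  refine ⟨![c₀, c₁], D, e₀, hD, he₀, hpar₀, ?_⟩
  refine formCongr_mul_diagonal_eq_smul_one σ P D J hPJ hD fun i => ?_
  fin_cases i
  · exact hce₀
  · rw [hee]; exact hce₁

end Frame

section Count

include hw in
/-- **(L5-d1) THE TRANSPORTED COUNT at an unramified non-split place (rank 2)**: for `J ∈ M₂(L_w)` `σ_w`-hermitian, `det J ≠ 0` of even order, and `γ ∈ U(σ_w, J)` with an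
eigenframe `γ P = P · diag(u)` (`u₀ ≠ u₁` of norm one), there is `e ∈ {0, 1}` — the parity of the order of `⟨p₀, p₀⟩_J` — with
`#S(J, γ) = #S(ϖ^e • 1, diag(u))`: the number of `γ`-stable `J`-self-dual lattices equals the NORMALISED count of (L5-b) for the form `ϖ^e • 1` and the diagonal
element `diag(u) = !![u₀, 0; 0, u₁]` (FILE A ★ `ncard_selfDualStable_eq_of_eigenframe_of_rescaling` at the rescaled frame). [cite: Flicker1998UnitaryFL, §6 p. 95]
[cite: Rogawski1990, §4.9 Lemma 4.9.3 p. 56] [cite: Kottwitz1986, §3] -/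
theorem exists_ncard_selfDualStable_eq_smul_one (hunr : Algebra.IsUnramifiedIn (𝓞 L) v.asIdeal)
    {J : Matrix (Fin 2) (Fin 2) (w.1.adicCompletion L)} (hJ : (J.map (galAdicCompletionMap (L := L) (IsCMField.complexConj L) hw))ᵀ = J)
    (hJ0 : J.det ≠ 0) (hJev : Even (WithZero.log (Valued.v J.det)))
    {γ P : GL (Fin 2) (w.1.adicCompletion L)} {u : Fin 2 → w.1.adicCompletion L}
    (hγ : γ ∈ Literature.AlgebraicGeometry.ShimuraVarieties.unitaryGroup (galAdicCompletionMap (L := L) (IsCMField.complexConj L) hw) J)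
    (hP : (γ : Matrix (Fin 2) (Fin 2) (w.1.adicCompletion L)) * P = P * diagonal u) (hu : Function.Injective u)
    (hu1 : ∀ i, galAdicCompletionMap (L := L) (IsCMField.complexConj L) hw (u i) * u i = 1) :
    ∃ e : ℕ, e ≤ 1 ∧
      (Even (WithZero.log (Valued.v (twistGram (galAdicCompletionMap (L := L) (IsCMField.complexConj L) hw) J P.val 0 0))) ↔ e = 0) ∧
      {Λ : Submodule 𝒪[w.1.adicCompletion L] (Fin 2 → w.1.adicCompletion L) |
          (∃ g : GL (Fin 2) (w.1.adicCompletion L),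
            (∃ J' ∈ glInt 2 (w.1.adicCompletion L), (J' : Matrix (Fin 2) (Fin 2) (w.1.adicCompletion L)) =
              formCongr (galAdicCompletionMap (L := L) (IsCMField.complexConj L) hw) g J) ∧
            Λ = Submodule.span 𝒪[w.1.adicCompletion L] (Set.range ((g : Matrix (Fin 2) (Fin 2) (w.1.adicCompletion L)))ᵀ)) ∧
          Λ.map ((Matrix.toLin' ((γ : GL (Fin 2) (w.1.adicCompletion L)) : Matrix (Fin 2) (Fin 2) (w.1.adicCompletion L))).restrictScalars
            𝒪[w.1.adicCompletion L]) = Λ}.ncard =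
      {Λ : Submodule 𝒪[w.1.adicCompletion L] (Fin 2 → w.1.adicCompletion L) |
          (∃ g : GL (Fin 2) (w.1.adicCompletion L),
            (∃ J' ∈ glInt 2 (w.1.adicCompletion L), (J' : Matrix (Fin 2) (Fin 2) (w.1.adicCompletion L)) =
              formCongr (galAdicCompletionMap (L := L) (IsCMField.complexConj L) hw) g
                (toPlace v w (HeckeCharacter.uniformizer ↥(maximalRealSubfield L) v : v.adicCompletion ↥(maximalRealSubfield L)) ^ e •
                  (1 : Matrix (Fin 2) (Fin 2) (w.1.adicCompletion L)))) ∧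
            Λ = Submodule.span 𝒪[w.1.adicCompletion L] (Set.range ((g : Matrix (Fin 2) (Fin 2) (w.1.adicCompletion L)))ᵀ)) ∧
          Λ.map ((Matrix.toLin' (diagonal u)).restrictScalars 𝒪[w.1.adicCompletion L]) = Λ}.ncard := by
  obtain ⟨c, D, e, hD, he1, hpar, hform⟩ :=
    exists_rescaling_formCongr_eq_uniformizer_pow_smul_one L v w hw hunr hJ hJ0 hJev hγ hP hu hu1
  have hHP : formCongr (galAdicCompletionMap (L := L) (IsCMField.complexConj L) hw) P J =
      diagonal fun i => twistGram (galAdicCompletionMap (L := L) (IsCMField.complexConj L) hw) J P.val i i :=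
    twistGram_eigenframe_eq_diagonal _ J hγ hP hu hu1
  refine ⟨e, he1, hpar, ?_⟩
  -- read the scalars off `hform`: `σ(cᵢ) dᵢ cᵢ = ϖ^e`
  have hc : ∀ i, galAdicCompletionMap (L := L) (IsCMField.complexConj L) hw (c i) *
      twistGram (galAdicCompletionMap (L := L) (IsCMField.complexConj L) hw) J P.val i i * c i =
        toPlace v w (HeckeCharacter.uniformizer ↥(maximalRealSubfield L) v : v.adicCompletion ↥(maximalRealSubfield L)) ^ e := by
    intro i
    have h := congrFun (congrFun hform i) i
    rw [formCongr_mul_diagonal_of_eq_diagonal _ P D J hHP hD, diagonal_apply_eq, Matrix.smul_apply, one_apply_eq, smul_eq_mul, mul_one] at h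
    exact h
  exact ncard_selfDualStable_eq_of_eigenframe_of_rescaling _ J γ P D hP hHP hD hc

end Count

/-! ## §5 The CM carriers: `Φ₂` at `w`, and the parity flip read on the norm test of ★ `LocalStableClassesNonsplitRankTwo` -/

section Carriers

/-- **The local form `(Φ₂)_w = placeForm Φ₂ w` is `σ_w`-hermitian** (its entries are `0, 1`). [cite: Rogawski1990, §3.5 p. 29] -/
theorem placeForm_antidiagTwo_hermitian :
    ((placeForm (Matrix.of fun i j : Fin 2 => if i.val + j.val + 1 = 2 then (1 : L) else 0) w.1).map
        (galAdicCompletionMap (L := L) (IsCMField.complexConj L) hw))ᵀ =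
      placeForm (Matrix.of fun i j : Fin 2 => if i.val + j.val + 1 = 2 then (1 : L) else 0) w.1 :=
  placeForm_hermitian_of_smul_eq (IsCMField.complexConj L) w _
    (by rw [← map_cmConjRingHom_eq_map_complexConj]; exact antidiagOne_isHermitian L 2) hw

omit [IsCMField L] in
/-- **`det (Φ₂)_w = −1`** (`Φ₂ = antidiag(1, 1)`). [cite: Rogawski1990, §3.5 p. 29] -/
theorem det_placeForm_antidiagTwo :
    (placeForm (Matrix.of fun i j : Fin 2 => if i.val + j.val + 1 = 2 then (1 : L) else 0) w.1).det = -1 := by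
  rw [placeForm_antidiagOne, ← antidiagOne_eq_over, Matrix.det_fin_two]
  simp [Matrix.of_apply]

omit [IsCMField L] in
/-- `det (Φ₂)_w ≠ 0` and its order is EVEN (`v_w(−1) = 1`, `log = 0`). [cite: Rogawski1990, §3.5 p. 29] -/
theorem det_placeForm_antidiagTwo_ne_zero_and_even :
    (placeForm (Matrix.of fun i j : Fin 2 => if i.val + j.val + 1 = 2 then (1 : L) else 0) w.1).det ≠ 0 ∧
      Even (WithZero.log (Valued.v
        (placeForm (Matrix.of fun i j : Fin 2 => if i.val + j.val + 1 = 2 then (1 : L) else 0) w.1).det)) := by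
  rw [det_placeForm_antidiagTwo]
  refine ⟨neg_ne_zero.2 one_ne_zero, ?_⟩
  rw [Valuation.map_neg, map_one, WithZero.log_one]
  exact Even.zero

include hw in
/-- **(L5-d1) AT `Φ₂`**: for `γ ∈ U(σ_w, (Φ₂)_w)(L_w)` with an eigenframe `γ P = P · diag(u)` of two distinct norm-one eigenvalues, at a place `v` unramified in `L`,
there is `e ∈ {0,1}` (the parity of the order of `⟨p₀, p₀⟩`) with `#S((Φ₂)_w, γ) = #S(ϖ^e • 1, diag(u))` — §4 with the `Φ₂`-hypotheses discharged; the left side is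
the set of the lattice-count socket ★ `classOrbitalIntegral_indicator_cmLocalIntegralLevel_eq_ncard_selfDual` at `N := 2`, `H := Φ₂`.
[cite: Flicker1998UnitaryFL, §6 p. 95] [cite: Rogawski1990, §4.9 Lemma 4.9.3 p. 56] -/
theorem exists_ncard_selfDualStable_antidiagTwo_eq_smul_one (hunr : Algebra.IsUnramifiedIn (𝓞 L) v.asIdeal)
    {γ P : GL (Fin 2) (w.1.adicCompletion L)} {u : Fin 2 → w.1.adicCompletion L}
    (hγ : γ ∈ Literature.AlgebraicGeometry.ShimuraVarieties.unitaryGroup (galAdicCompletionMap (L := L) (IsCMField.complexConj L) hw)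
      (placeForm (Matrix.of fun i j : Fin 2 => if i.val + j.val + 1 = 2 then (1 : L) else 0) w.1))
    (hP : (γ : Matrix (Fin 2) (Fin 2) (w.1.adicCompletion L)) * P = P * diagonal u) (hu : Function.Injective u)
    (hu1 : ∀ i, galAdicCompletionMap (L := L) (IsCMField.complexConj L) hw (u i) * u i = 1) :
    ∃ e : ℕ, e ≤ 1 ∧
      (Even (WithZero.log (Valued.v (twistGram (galAdicCompletionMap (L := L) (IsCMField.complexConj L) hw)
        (placeForm (Matrix.of fun i j : Fin 2 => if i.val + j.val + 1 = 2 then (1 : L) else 0) w.1) P.val 0 0))) ↔ e = 0) ∧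
      {Λ : Submodule 𝒪[w.1.adicCompletion L] (Fin 2 → w.1.adicCompletion L) |
          (∃ g : GL (Fin 2) (w.1.adicCompletion L),
            (∃ J' ∈ glInt 2 (w.1.adicCompletion L), (J' : Matrix (Fin 2) (Fin 2) (w.1.adicCompletion L)) =
              formCongr (galAdicCompletionMap (L := L) (IsCMField.complexConj L) hw) g
                (placeForm (Matrix.of fun i j : Fin 2 => if i.val + j.val + 1 = 2 then (1 : L) else 0) w.1)) ∧
            Λ = Submodule.span 𝒪[w.1.adicCompletion L] (Set.range ((g : Matrix (Fin 2) (Fin 2) (w.1.adicCompletion L)))ᵀ)) ∧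
          Λ.map ((Matrix.toLin' ((γ : GL (Fin 2) (w.1.adicCompletion L)) : Matrix (Fin 2) (Fin 2) (w.1.adicCompletion L))).restrictScalars
            𝒪[w.1.adicCompletion L]) = Λ}.ncard =
      {Λ : Submodule 𝒪[w.1.adicCompletion L] (Fin 2 → w.1.adicCompletion L) |
          (∃ g : GL (Fin 2) (w.1.adicCompletion L),
            (∃ J' ∈ glInt 2 (w.1.adicCompletion L), (J' : Matrix (Fin 2) (Fin 2) (w.1.adicCompletion L)) =
              formCongr (galAdicCompletionMap (L := L) (IsCMField.complexConj L) hw) g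
                (toPlace v w (HeckeCharacter.uniformizer ↥(maximalRealSubfield L) v : v.adicCompletion ↥(maximalRealSubfield L)) ^ e •
                  (1 : Matrix (Fin 2) (Fin 2) (w.1.adicCompletion L)))) ∧
            Λ = Submodule.span 𝒪[w.1.adicCompletion L] (Set.range ((g : Matrix (Fin 2) (Fin 2) (w.1.adicCompletion L)))ᵀ)) ∧
          Λ.map ((Matrix.toLin' (diagonal u)).restrictScalars 𝒪[w.1.adicCompletion L]) = Λ}.ncard :=
  exists_ncard_selfDualStable_eq_smul_one L v w hw hunr (placeForm_antidiagTwo_hermitian L v w hw)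
    (det_placeForm_antidiagTwo_ne_zero_and_even L v w).1 (det_placeForm_antidiagTwo_ne_zero_and_even L v w).2 hγ hP hu hu1

include hw in
/-- **THE PARITY FLIP READ ON THE NORM TEST OF THE (L5-e) PAIR** (CM carriers `E_v = L ⊗ L⁺_v = Π_{w∣v} L_w`, ★ `LocalStableClassesNonsplitRankTwo` currency): for
`H ∈ M₂(E_v)` hermitian with unit determinant, `γ ∈ U(H)(L⁺_v)` with an eigenframe `γ P = P · diag(u)` (`u₀ ≠ u₁`, norm one) and a stable conjugator `g` FAILING the norm
test (`¬ ∃ z ∈ E_vˣ, (H_{gP})₀₀ = σ(z) z · (H_P)₀₀` — the second class `t₂` of ★ `exists_conjClassesIn_eq_pair_rankTwo`), the orders AT `w` of the two eigenvector lengths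
`(H_{gP})₀₀`, `(H_P)₀₀` have DIFFERENT parity: the two classes carry `e` and `1 − e` (`v` unramified in `L`).
[cite: Flicker1998UnitaryFL, §6 p. 95] [cite: Omeara1963, §63C Example 63:16] [cite: Rogawski1990, §3.5 Prop. 3.5.2 (c) p. 29] -/
theorem even_log_twistGram_apply_iff_not_of_not_normTest (hunr : Algebra.IsUnramifiedIn (𝓞 L) v.asIdeal)
    {H : Matrix (Fin 2) (Fin 2) (LocalRing L v)} (hH : (H.map (conjLocal L (IsCMField.complexConj L) v))ᵀ = H) (hHd : IsUnit H.det)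
    {γ P : GL (Fin 2) (LocalRing L v)} {u : Fin 2 → LocalRing L v}
    (hγ : γ ∈ Literature.AlgebraicGeometry.ShimuraVarieties.unitaryGroup (conjLocal L (IsCMField.complexConj L) v) H)
    (hP : γ.val * P.val = P.val * diagonal u) (hu : Function.Injective u) (hu1 : ∀ i, conjLocal L (IsCMField.complexConj L) v (u i) * u i = 1)
    {g : GL (Fin 2) (LocalRing L v)} (hg : g * γ * g⁻¹ ∈ Literature.AlgebraicGeometry.ShimuraVarieties.unitaryGroup (conjLocal L (IsCMField.complexConj L) v) H)
    (hT : ¬ ∃ z : LocalRing L v, IsUnit z ∧ twistGram (conjLocal L (IsCMField.complexConj L) v) H (g.val * P.val) 0 0 =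
      conjLocal L (IsCMField.complexConj L) v z * z * twistGram (conjLocal L (IsCMField.complexConj L) v) H P.val 0 0) :
    Even (WithZero.log (Valued.v ((twistGram (conjLocal L (IsCMField.complexConj L) v) H (g.val * P.val) 0 0) w))) ↔
      ¬ Even (WithZero.log (Valued.v ((twistGram (conjLocal L (IsCMField.complexConj L) v) H P.val 0 0) w))) := by
  have hc1 : IsCMField.complexConj L ≠ 1 := IsCMField.complexConj_ne_one L
  haveI : Subsingleton (PlacesOver L v) := PlacesOver.subsingleton_of_smul_eq (IsCMField.complexConj L) hc1 w hw
  letI : Field (LocalRing L v) := (LocalRing.isField_of_smul_eq (IsCMField.complexConj L) hc1 w hw).toField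
  have hσσ : ∀ s, conjLocal L (IsCMField.complexConj L) v (conjLocal L (IsCMField.complexConj L) v s) = s := fun s => by
    rw [LocalRing.eq_iff_apply_eq (IsCMField.complexConj L) hc1 w hw, conjLocal_apply_eq_galAdicCompletionMap L v w hw,
      conjLocal_apply_eq_galAdicCompletionMap L v w hw]
    exact galAdicCompletionMap_galAdicCompletionMap_of_smul_eq (IsCMField.complexConj L) w hc1 hw (s w)
  -- the two lengths: `σ`-fixed, non-zero
  set A := twistGram (conjLocal L (IsCMField.complexConj L) v) H (g.val * P.val) 0 0 with hA
  set B := twistGram (conjLocal L (IsCMField.complexConj L) v) H P.val 0 0 with hB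
  have hAfix : conjLocal L (IsCMField.complexConj L) v A = A := map_twistGram_apply_self _ H hσσ hH _ 0
  have hBfix : conjLocal L (IsCMField.complexConj L) v B = B := map_twistGram_apply_self _ H hσσ hH _ 0
  have hA0 : A ≠ 0 := twistGram_mul_eigenframe_apply_ne_zero _ H hHd.ne_zero hγ hP hu hu1 hg 0
  have hB0 : B ≠ 0 := twistGram_eigenframe_apply_ne_zero _ H hHd.ne_zero hγ hP hu hu1 0
  -- read at `w`
  have hAw : galAdicCompletionMap (L := L) (IsCMField.complexConj L) hw (A w) = A w := by
    rw [← conjLocal_apply_eq_galAdicCompletionMap L v w hw, hAfix]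
  have hBw : galAdicCompletionMap (L := L) (IsCMField.complexConj L) hw (B w) = B w := by
    rw [← conjLocal_apply_eq_galAdicCompletionMap L v w hw, hBfix]
  have hAw0 : A w ≠ 0 := fun h0 => hA0 ((LocalRing.eq_iff_apply_eq (IsCMField.complexConj L) hc1 w hw A 0).2 (by rw [h0]; rfl))
  have hBw0 : B w ≠ 0 := fun h0 => hB0 ((LocalRing.eq_iff_apply_eq (IsCMField.complexConj L) hc1 w hw B 0).2 (by rw [h0]; rfl))
  refine even_log_iff_not_even_log_of_not_exists_eq_norm_mul L v w hw hunr hAw hAw0 hBw hBw0 fun ⟨z, hz0, hz⟩ => hT ?_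
  -- lift `z ∈ L_w` to `E_v` (one factor)
  letI : Unique (PlacesOver L v) := uniqueOfSubsingleton w
  let π : LocalRing L v ≃+* w.1.adicCompletion L := RingEquiv.piUnique fun w' : PlacesOver L v => w'.1.adicCompletion L
  obtain ⟨Z, hZw⟩ : ∃ Z : LocalRing L v, Z w = z := ⟨π.symm z, π.apply_symm_apply z⟩
  have hZ0 : Z ≠ 0 := fun h0 => hz0 (by rw [← hZw, h0]; rfl)
  refine ⟨Z, isUnit_iff_ne_zero.2 hZ0, (LocalRing.eq_iff_apply_eq (IsCMField.complexConj L) hc1 w hw _ _).2 ?_⟩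
  rw [Pi.mul_apply, Pi.mul_apply, conjLocal_apply_eq_galAdicCompletionMap L v w hw Z, hZw]
  exact hz

end Carriers

/-! ## §6 The consumer's shape: form `ϖ ^ (e : ℤ) • 1`, element a `GL₂` representative of `!![u₀, 0; 0, u₁]` -/

section ConsumerShape

omit [IsCMField L] in
/-- `diagonal u = !![u₀, 0; 0, u₁]` (matrix bookkeeping). [folklore] -/
private theorem diagonal_eq_fin_two (u : Fin 2 → w.1.adicCompletion L) :
    (diagonal u : Matrix (Fin 2) (Fin 2) (w.1.adicCompletion L)) = !![u 0, 0; 0, u 1] := by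
  ext i j
  fin_cases i <;> fin_cases j <;> simp [Matrix.diagonal]

include hw in
/-- **(L5-d1) IN THE CONSUMER'S SHAPE** (B-p10 (g24)'s normalised count ★ `ncard_selfDualStable_smul_one_diag_eq_sum`: form `ϖ ^ (e : ℤ) • 1`, element a `GL₂`
representative `γ′` with `↑γ′ = !![u₀, 0; 0, u₁]`): at a place `v` unramified in `L`, for `γ ∈ U(σ_w, (Φ₂)_w)(L_w)` with an eigenframe `γ P = P · diag(u)` (`u₀ ≠ u₁`
of norm one) there are `e ∈ {0,1}` (the parity of the order of `⟨p₀, p₀⟩`) and `γ′ := (P D)⁻¹ γ (P D)` with `↑γ′ = !![u₀, 0; 0, u₁]` and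
`#S((Φ₂)_w, γ) = #S(ϖ ^ (e : ℤ) • 1, γ′)`. [cite: Flicker1998UnitaryFL, §6 p. 95] [cite: Rogawski1990, §4.9 Lemma 4.9.3 p. 56] [cite: Kottwitz1986, §3] -/
theorem exists_ncard_selfDualStable_antidiagTwo_eq_zpow_smul_one (hunr : Algebra.IsUnramifiedIn (𝓞 L) v.asIdeal)
    {γ P : GL (Fin 2) (w.1.adicCompletion L)} {u : Fin 2 → w.1.adicCompletion L}
    (hγ : γ ∈ Literature.AlgebraicGeometry.ShimuraVarieties.unitaryGroup (galAdicCompletionMap (L := L) (IsCMField.complexConj L) hw)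
      (placeForm (Matrix.of fun i j : Fin 2 => if i.val + j.val + 1 = 2 then (1 : L) else 0) w.1))
    (hP : (γ : Matrix (Fin 2) (Fin 2) (w.1.adicCompletion L)) * P = P * diagonal u) (hu : Function.Injective u)
    (hu1 : ∀ i, galAdicCompletionMap (L := L) (IsCMField.complexConj L) hw (u i) * u i = 1) :
    ∃ (e : ℕ) (γ' : GL (Fin 2) (w.1.adicCompletion L)), e ≤ 1 ∧
      (Even (WithZero.log (Valued.v (twistGram (galAdicCompletionMap (L := L) (IsCMField.complexConj L) hw)
        (placeForm (Matrix.of fun i j : Fin 2 => if i.val + j.val + 1 = 2 then (1 : L) else 0) w.1) P.val 0 0))) ↔ e = 0) ∧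
      (γ' : Matrix (Fin 2) (Fin 2) (w.1.adicCompletion L)) = !![u 0, 0; 0, u 1] ∧
      {Λ : Submodule 𝒪[w.1.adicCompletion L] (Fin 2 → w.1.adicCompletion L) |
          (∃ g : GL (Fin 2) (w.1.adicCompletion L),
            (∃ J' ∈ glInt 2 (w.1.adicCompletion L), (J' : Matrix (Fin 2) (Fin 2) (w.1.adicCompletion L)) =
              formCongr (galAdicCompletionMap (L := L) (IsCMField.complexConj L) hw) g
                (placeForm (Matrix.of fun i j : Fin 2 => if i.val + j.val + 1 = 2 then (1 : L) else 0) w.1)) ∧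
            Λ = Submodule.span 𝒪[w.1.adicCompletion L] (Set.range ((g : Matrix (Fin 2) (Fin 2) (w.1.adicCompletion L)))ᵀ)) ∧
          Λ.map ((Matrix.toLin' ((γ : GL (Fin 2) (w.1.adicCompletion L)) : Matrix (Fin 2) (Fin 2) (w.1.adicCompletion L))).restrictScalars
            𝒪[w.1.adicCompletion L]) = Λ}.ncard =
      {Λ : Submodule 𝒪[w.1.adicCompletion L] (Fin 2 → w.1.adicCompletion L) |
          (∃ g : GL (Fin 2) (w.1.adicCompletion L),
            (∃ J' ∈ glInt 2 (w.1.adicCompletion L), (J' : Matrix (Fin 2) (Fin 2) (w.1.adicCompletion L)) =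
              formCongr (galAdicCompletionMap (L := L) (IsCMField.complexConj L) hw) g
                ((toPlace v w (HeckeCharacter.uniformizer ↥(maximalRealSubfield L) v : v.adicCompletion ↥(maximalRealSubfield L)) ^ (e : ℤ)) •
                  (1 : Matrix (Fin 2) (Fin 2) (w.1.adicCompletion L)))) ∧
            Λ = Submodule.span 𝒪[w.1.adicCompletion L] (Set.range ((g : Matrix (Fin 2) (Fin 2) (w.1.adicCompletion L)))ᵀ)) ∧
          Λ.map ((Matrix.toLin' ((γ' : GL (Fin 2) (w.1.adicCompletion L)) : Matrix (Fin 2) (Fin 2) (w.1.adicCompletion L))).restrictScalars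
            𝒪[w.1.adicCompletion L]) = Λ}.ncard := by
  obtain ⟨c, D, e, hD, he1, hpar, hform⟩ :=
    exists_rescaling_formCongr_eq_uniformizer_pow_smul_one L v w hw hunr (placeForm_antidiagTwo_hermitian L v w hw)
      (det_placeForm_antidiagTwo_ne_zero_and_even L v w).1 (det_placeForm_antidiagTwo_ne_zero_and_even L v w).2 hγ hP hu hu1
  refine ⟨e, (P * D)⁻¹ * γ * (P * D), he1, hpar, ?_, ?_⟩
  · rw [inv_mul_mul_eq_diagonal_of_eigenframe γ P D hP hD, diagonal_eq_fin_two]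
  · rw [ncard_selfDualStable_congr (galAdicCompletionMap (L := L) (IsCMField.complexConj L) hw) _ γ (P * D), hform, zpow_natCast]

end ConsumerShape

end Literature.NumberTheory.Automorphic.UnitaryGroup

end
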